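import Summits.QuantumFields.BalabanUV.Beta.FP.NestedStepLawTorusCompositeOneShot
import Summits.QuantumFields.BalabanUV.Beta.FP.NestedStepLawTorusCompositeGB

/-!
# BOUNDED-LEVELS TWIN `NestedStepLawTorusCompositeOneShotGB` (R-FP-76, the repair of E-FP-34-1, journal l.64955): the statements and proofs of `NestedStepLawTorusCompositeOneShotG` VERBATIM but for the displayed
# clause `hlev : ∀ i, i ≤ n → lev i = lev (i + 1) + 1` (the original `∀ i, lev i = lev (i + 1) + 1` is unsatisfiable for `lev : ℕ → ℕ`, so the original theorem is
# vacuous — kernel-proved, `HOME/b2b-balaban-beta-d1-p3/g34/hlev/HlevVacuous.lean`) and the `B` suppliers; helper lemmas without `hlev` are imported from the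
# original, not re-declared.  Generator `HOME/b2b-balaban-beta-d1-p3/g34/recut/recutB.py` over the TREE bytes.  Road «FP» OWNER d1-p3 gen 34, 2026-08-25.  ORIGINAL HEADER:
# `BalabanUV.Beta.FP.NestedStepLawTorusCompositeOneShotG` — road «FP» for binder row D1, ROUTE T under RULING R-D1-g52-1 (β1) ∕ R-FP-70: **THE `-G` EDITION OF #20
# `NestedStepLawTorusCompositeOneShot` — THE (j, m ≥ 2) TORUS CALL WITH THE FINE SYSTEM SLICED BY ITS ONE-SHOT BIG COMB, GENERIC OVER `(Q : StepRows d Lc, K)`**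

WHAT.  #20's binder block and proof VERBATIM but for: the pins over `K (lev (n+1)) (rs (n+1))` (finest form) and `compRowsG Lc Q` (composite rows; the fine slice
`bigP`, the top comb `combF`, the generators `towerGen`, the big comb `bigP` are brick-free and stay pinned); the top step's rows `Q₂₀` ABSTRACT; the NINE brick
inputs of #20's proof DISPLAYED (R-FP-70 + R-FP-71 «display what you use») — `hH₀t : H₀ᵀ = H₀`, leaf-05's one-step letters `hone ∕ hId` (fed to `TorusEffFormCompositeG.torus_composite_inv_and_eff_G`), the top
step's comb-sliced KKT `htop`, `a0 : H₀ * W₀ = 0`, leaf-02's composite covariance row ORDER 0 AT THE TOP DEPTH in the pinned letters (`c0 : Q₁₀ * W₀ = fromCols Dbar 0`), the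
LOWER tower's nested-slice transversality `hSL` and the one-shot slice's `hTW` (leaf-06 G-1 ∕ G-2's CONCLUSIONS at this instance — R-FP-71: the universal-in-`ρs`
family `hc0` of v1 is NOT displayed, it is unsatisfiable at the (0.4)-sym kernel off the centred root list, leaf-02 g31 W-1 l.56632), and the top step's
order 0 `d0 : Q₂₀ * Dbar = 0`.  Everything else — the remaining (SLICE-m) letters inside by leaf-06's brick-free letters, (INV)(EFF) across the slice change by an2's Literature
`GaugeFixingPropagators`, `j1 j2 uC uP′ hPW` inside, the displayed rows `c1 c2 d1 d2 k1 k2 q1 q2 a1 a2 hH₁t hH₂t hDb₁ hDb₂`, the CONCLUSION — character for character #20's.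
Instances: ROOTED (`Q := Qstep Lc`, `K ℓ r := bhKStepAt d (toSite r) Lc ℓ`) = #20 with `torus_a0_tower ∕ compRows_mul_towerGen_succ ∕ Qtop_mul_smul_tgrad_res ∕ H₀_transpose_of_dvd ∕
torus_h1 ∕ hId_order_zero_record ∕ torus_isUnit_det_kkt_combRows`; SYM (`Q := QSym Lc`, `K ℓ _ := bhKStepSh d Lc (Dsh Lc) ℓ`) with leaf-05's chart-(III′) letters and
leaf-02's sym rows — typed with #21-Sym.  [folklore] composition BY NAME; no `def`, no `def … : Prop`, nothing cited, 0 sorry.  Rows, legs and namings are HYPOTHESES;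
nothing of the dictionary ∕ Bałaban's asserted (the presentation is the row's (β1) ruling, quoted).  No existing file touched.

HONEST DEPENDENCY (page 1, mandatory): continuum YM on T⁴ ⇐ BetaPertH ∧ nine spine estimates (0/9 proved); BetaPertH ⇐ (D1) ∧ (D4) ∧ CAP+tail;
G-an2-4 gates asym, D1 and NE2/3/4.  HONEST FRAMING (cell contract, verbatim): «discharging `BetaPertH` makes Bałaban's UV stability UNCONDITIONAL —
a real constructive-QFT result; it is NOT the continuum limit and NOT the Clay problem.»  ABSOLUTE RULE (cell charter, verbatim): «No internally-minted
statement may enter as a cited fact. Every hypothesis is either kernel-proved in this package or a verbatim quotation of a PUBLISHED theorem with page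
reference. The manuscript(s) under audit are NOT citable for their own disputed steps — they are the thing under adjudication; programme-internal
(2001/route/tribunal) claims are never citable.»  0 estimates; 0∕4 row-D1 binders (hW, hR, D1Tel, D1Rep); ROOT M‴ p325680 untouched; NOT (C1), NOT (L2′),
NOT (T-ID), NOT SDF, NOT D1, NOT BetaPertH, NOT continuum, NOT Clay.  Road «FP» OWNER, b2b-balaban-beta-d1-p3 gen 29 (v1) ∕ gen 31 (v2, R-FP-71), 2026-08-24.  No existing file touched.
-/

noncomputable section

namespace Summit.QuantumFields.BalabanUV.Beta.FP.NestedStepLawTorusCompositeOneShotGB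

open Matrix
open Literature.MathematicalPhysics.QuantumFieldTheory.Balaban1983to89
open Literature.MathematicalPhysics.QuantumFieldTheory.Balaban1983to89.Beta
open Literature.MathematicalPhysics.QuantumFieldTheory.Balaban1983to89.Beta.Composition (kkt)
open Literature.MathematicalPhysics.QuantumFieldTheory.Balaban1983to89.Beta.CompositionSingular (effForm flucCov minOp minOpL)
open B5Prop11Plancherel (fine)
open B6Lemma24Torus (pbox mem_pbox)
open AffineAveraging (Site box toSite)
open OneStepResolventKernel (Fib)
open Summit.QuantumFields.BalabanUV.Beta.BorderedHessian (bhKStepAt)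
open Summit.QuantumFields.BalabanUV.Beta.AxialDressingRooted (IsCombBondAt)
open Summit.QuantumFields.BalabanUV.Beta.D1BFx.LogDetSecondVariation (secondVar)
open Summit.QuantumFields.BalabanUV.Beta.FP.KernelPeriodisationFib (Idx perF perF_apply perZ perZ_apply trF perF_transpose)
open Summit.QuantumFields.BalabanUV.Beta.FP.TorusCombRows (Res)
open Summit.QuantumFields.BalabanUV.Beta.FP.CompositeWardLetters (compWard_b0 compWard_b1 compWard_b2)
open Summit.QuantumFields.BalabanUV.Beta.FP.NestedStepLawTransported (secondVar_nestedFP_eq_zero)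
open Summit.QuantumFields.BalabanUV.Beta.FP.NestedStepLawTransportedExpGraded (secondVar_oneShot_nestedStepLaw_expTransported_graded_of_uni)
open Summit.QuantumFields.BalabanUV.Beta.FP.TorusCompositeObjects (towerTorus towerTorus_apply compRows nestedSlice NParam Qstep combF bigP towerGen
  towerGen_succ bigRoot bigRatio bigRatio_pos bigRatio_eq_pow pboxCongr pboxCongr_coe)
open Summit.QuantumFields.BalabanUV.Beta.FP.TorusCompositeUnimodular (det_bigP_mul_towerGen_ne_zero)
open Summit.QuantumFields.BalabanUV.Beta.FP.TorusCompositeFP (evalN torus_uP_exp_tower)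
open Summit.QuantumFields.BalabanUV.Beta.FP.TorusCompositeIntertwining (towerC₁ torus_j1_tower torus_j2_tower)
open Summit.QuantumFields.BalabanUV.Beta.FP.TorusGeneratorIntertwining (torus_uC_exp)
open Summit.QuantumFields.BalabanUV.Beta.FP.TorusGaugeCovariance (tgrad)
open Summit.QuantumFields.BalabanUV.Beta.FP.NestedStepLawTorusComposite (H₀_transpose_of_dvd dvd_towerTorus_succ)
open Summit.QuantumFields.BalabanUV.Beta.GAN24.FineReadoutCauchyFrame (toSite_mem_range)
open AffineAveraging (unitVec)
open Summit.QuantumFields.BalabanUV.Beta.FP.TorusEffFormComposite (torus_composite_inv_and_eff)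
open Summit.QuantumFields.BalabanUV.Beta.FP.RelInvPeriodisedCoarse (det_kkt_smul_form_ne_zero_iff)
open Summit.QuantumFields.BalabanUV.Beta.FP.RelInvPeriodisedCombRows (torus_isUnit_det_kkt_combRows)
open Summit.QuantumFields.BalabanUV.Beta.FP.RelInvPeriodisedEffFormCoarse (wVH_pos)
open Summit.QuantumFields.BalabanUV.Beta.FP.NestedStepLawTorusInstance (dvd_fine)
open Summit.QuantumFields.BalabanUV.Beta.FP.TorusCompositeSlice (det_nestedSlice_mul_towerGen_ne_zero torus_t1_tower_of_c1 torus_t2_tower_of_c2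
  det_combF_mul_smul_tgrad_res_ne_zero prod_stepScale_mul_card_ne_zero)
open Summit.QuantumFields.BalabanUV.Beta.FP.NestedFPSplit (secondVar_nestedFP_eq_zero_of_t_uLow)
open Summit.QuantumFields.BalabanUV.Beta.FP.TorusCompositeCovariance (compRows_mul_towerGen_succ Qtop_mul_smul_tgrad_res)
open Summit.QuantumFields.BalabanUV.Beta.FP.PeriodisedWardOrderZero (sum_perZ_bhKStepAt_ff_mul_tgrad sum_perZ_bhKStepAt_ff_mul_grad_periodic abs_tdelta_le)
open Summit.QuantumFields.BalabanUV.Beta.FP.TorusGaugeCovariance (tdelta)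
open Summit.QuantumFields.BalabanUV.Beta.FP.TorusGaugeCovarianceCoarse (tgradBlock tgradBlock_inl tdelta_quo_congr)
open Summit.QuantumFields.BalabanUV.Beta.BorderedHessian (stepScale)
open Literature.MathematicalPhysics.QuantumFieldTheory.LatticeForm (quo)
open Literature.MathematicalPhysics.QuantumFieldTheory.Balaban1983to89.B4TorusKernel.MultiPeriod (translate_apply)
open Summit.QuantumFields.BalabanUV.Beta.FP.TorusCompositeSliceOneShot (torus_hTW_oneShot_tower torus_uLow_oneShot_tower)
open Literature.MathematicalPhysics.QuantumFieldTheory.Balaban1983to89.Beta.GaugeFixingPropagators (isUnit_det_kkt_sliceChange₃ blocks_sliceChange₃)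
open Literature.Probability.LatticeModels (Torus.proj)
open BalabanStepJetsSucc (wVH)
open Finset
open Summit.QuantumFields.BalabanUV.Beta.FP.TorusCompositeObjectsG (StepRows compRowsG nestedSliceG)
open Summit.QuantumFields.BalabanUV.Beta.FP.TorusEffFormCompositeGB (torus_composite_inv_and_eff_G)
open ExpKernelCalculus (MKer)

variable {d : ℕ}

section CompositeOneShotG

variable (M' : Fin (d + 1) → ℕ) [∀ μ, NeZero (M' μ)] (Lc : ℕ) [NeZero Lc] (lev : ℕ → ℕ) (rs : ℕ → (Fin (d + 1) → ℕ)) (n : ℕ)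

set_option synthInstance.maxSize 1024 in
/-- [folklore] **`-G` OF #20 `…_graded_oneShot`** — generic over the step-row family `Q` and the form family `K`; #20's binders and proof VERBATIM but for the
pins and the nine displayed brick inputs (`hH₀t hone hId htop a0 hSL c0 hTW d0` — R-FP-71: G-1 ∕ G-2's conclusions `hSL hTW` and the top (COV-m)
order 0 `c0` are displayed AS USED, no universal covariance family). -/
theorem secondVar_oneShot_nestedStepLaw_torus_composite_graded_oneShot_G (Q : StepRows d Lc) (K : ℕ → (Fin (d + 1) → ℕ) → MKer (d + 1) (Fib d)) (hrs : ∀ k, rs k ∈ box (d + 1) Lc) (hlev : ∀ i, i ≤ n → lev i = lev (i + 1) + 1)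
    (hM' : ∀ i, Lc ∣ M' i)
    -- the top step's multiplier index type (abstract; at the instances: (B)'s slot presentation one level above `M′`)
    {κ : Type*} [Fintype κ] [DecidableEq κ]
    -- the composite objects PINNED over the abstract families: finest form `K (lev (n+1)) (rs (n+1))`, rows `compRowsG Lc Q`, nested slice `nestedSliceG Lc Q`
    {H₀ : Matrix (↥(pbox (towerTorus Lc M' (n + 1))) × Fin (d + 1)) (↥(pbox (towerTorus Lc M' (n + 1))) × Fin (d + 1)) ℝ}
    {Q₁₀ : Matrix (↥(pbox M') × Fin (d + 1)) (↥(pbox (towerTorus Lc M' (n + 1))) × Fin (d + 1)) ℝ}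
    {τ₁ : Matrix (NParam Lc (fine Lc M') (fun k => rs (k + 1)) n) (↥(pbox (towerTorus Lc M' (n + 1))) × Fin (d + 1)) ℝ}
    (hH₀ : H₀ = (perF (towerTorus Lc M' (n + 1)) (K (lev (n + 1)) (rs (n + 1)))).submatrix
        (fun b : ↥(pbox (towerTorus Lc M' (n + 1))) × Fin (d + 1) => ((b.1, Sum.inl b.2) : Idx (towerTorus Lc M' (n + 1)) (Fib d)))
        (fun b : ↥(pbox (towerTorus Lc M' (n + 1))) × Fin (d + 1) => ((b.1, Sum.inl b.2) : Idx (towerTorus Lc M' (n + 1)) (Fib d))))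
    (hQ₁₀ : Q₁₀ = compRowsG Lc Q M' lev rs (n + 1))
    -- R-FP-55 (α): the fine slice is the ONE-SHOT big comb of the tower below (leaf-06 `bigP`), NOT the nested slice
    (hτ₁ : τ₁ = bigP Lc (fine Lc M') (fun k => rs (k + 1)) (fun k => toSite_mem_range (hrs (k + 1))) n)
    -- DISPLAYED BRICK INPUTS (discharged per instance): the finest form block is symmetric; leaf-05's one-step letters (h1)ₖ ∕ (hId)ₖ at every storey
    (hH₀t : H₀ᵀ = H₀)
    (hone : ∀ (k : ℕ) (T : Fin (d + 1) → ℕ) [∀ μ, NeZero (T μ)],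
      (kkt ((perF (fine Lc T) (K (lev k) (rs k))).submatrix
            (fun b : ↥(pbox (fine Lc T)) × Fin (d + 1) => ((b.1, Sum.inl b.2) : Idx (fine Lc T) (Fib d)))
            (fun b : ↥(pbox (fine Lc T)) × Fin (d + 1) => ((b.1, Sum.inl b.2) : Idx (fine Lc T) (Fib d))))
        (fromRows (Q T (lev k) (rs k)) (combF Lc (fine Lc T) (rs k)))).det ≠ 0)
    (hId : ∀ (k : ℕ) (T : Fin (d + 1) → ℕ) [∀ μ, NeZero (T μ)] (r' : Fin (d + 1) → ℕ),
      (effForm ((perF (fine Lc T) (K (lev k) (rs k))).submatrix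
            (fun b : ↥(pbox (fine Lc T)) × Fin (d + 1) => ((b.1, Sum.inl b.2) : Idx (fine Lc T) (Fib d)))
            (fun b : ↥(pbox (fine Lc T)) × Fin (d + 1) => ((b.1, Sum.inl b.2) : Idx (fine Lc T) (Fib d))))
          (fromRows (Q T (lev k) (rs k)) (combF Lc (fine Lc T) (rs k)))).toBlocks₁₁
        = (wVH d Lc (lev k + 1))⁻¹ • (perF T (K (lev k + 1) r')).submatrix
            (fun b : ↥(pbox T) × Fin (d + 1) => ((b.1, Sum.inl b.2) : Idx T (Fib d)))
            (fun b : ↥(pbox T) × Fin (d + 1) => ((b.1, Sum.inl b.2) : Idx T (Fib d))))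
    -- (SLICE-m) OF THE TOWER BELOW `M′`, DISPLAYED (R-FP-71 «display what you use»): its NESTED comb slice is transversal to its generators
    -- (rooted: leaf-06 `TorusCompositeSlice.det_nestedSlice_mul_towerGen_ne_zero`; sym: leaf-06's G-1 sym theorem at the constant root list, fed leaf-02's R-20)
    (hSL : (nestedSliceG Lc Q (fine Lc M') (fun k => lev (k + 1)) (fun k => rs (k + 1)) n
        * towerGen Lc (fine Lc M') (fun k => rs (k + 1)) n).det ≠ 0)
    {τ₂ : Matrix (Res (toSite (rs 0)) Lc M') (↥(pbox M') × Fin (d + 1)) ℝ} (hτ₂ : τ₂ = combF Lc M' (rs 0))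
    -- the top step's averaging rows ABSTRACT; its comb-sliced KKT non-degeneracy over the form `K (lev 0) (rs 0)` DISPLAYED (`htop`)
    (Q₂₀ : Matrix κ (↥(pbox M') × Fin (d + 1)) ℝ)
    (htop : (kkt ((perF M' (K (lev 0) (rs 0))).submatrix (fun b : ↥(pbox M') × Fin (d + 1) => ((b.1, Sum.inl b.2) : Idx M' (Fib d)))
        (fun b : ↥(pbox M') × Fin (d + 1) => ((b.1, Sum.inl b.2) : Idx M' (Fib d)))) (fromRows Q₂₀ τ₂)).det ≠ 0)
    -- the tower's generators and the one-shot big comb: FREE matrices of the tower's types in v1 (pinned to leaf-06's `towerGen ∕ bigP` by the (SLICE-m) ∕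
    -- (COV-m) suppliers in v1.1; target shape 36f428fe4d8b64c2)
    {W₀ : Matrix (↥(pbox (towerTorus Lc M' (n + 1))) × Fin (d + 1)) (NParam Lc M' rs (n + 1)) ℝ} (hW₀ : W₀ = towerGen Lc M' rs (n + 1))
    {P : Matrix (NParam Lc M' rs (n + 1)) (↥(pbox (towerTorus Lc M' (n + 1))) × Fin (d + 1)) ℝ} (hP : P = bigP Lc M' rs (fun k => toSite_mem_range (hrs k)) (n + 1))
    -- the displayed jets: form (finest level), composite averaging, the top step's averaging jets, generators, witnesses, composite covariance images
    (H₁ H₂ : Matrix (↥(pbox (towerTorus Lc M' (n + 1))) × Fin (d + 1)) (↥(pbox (towerTorus Lc M' (n + 1))) × Fin (d + 1)) ℝ)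
    (Q₁₁ Q₁₂ : Matrix (↥(pbox M') × Fin (d + 1)) (↥(pbox (towerTorus Lc M' (n + 1))) × Fin (d + 1)) ℝ)
    (Q₂₁ Q₂₂ : Matrix κ (↥(pbox M') × Fin (d + 1)) ℝ)
    -- the finest-level transport generator `X = −c·diag(λ)`, the tower's generator jets `W₁ W₂` (weight `h`) and the one-shot generator jets `W′₁ W′₂`
    -- (weight `h + Dλ`) PINNED to the exponential closed forms of leaf-06's `TorusCompositeIntertwining` ∕ `TorusCompositeFP` (parameters `λ`, `c`, `h`)
    (lam : ↥(pbox (towerTorus Lc M' (n + 1))) → ℝ) (c : ℝ) (h : (↥(pbox (towerTorus Lc M' (n + 1))) × Fin (d + 1)) → ℝ)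
    {W₁ W₂ : Matrix (↥(pbox (towerTorus Lc M' (n + 1))) × Fin (d + 1)) (NParam Lc M' rs (n + 1)) ℝ}
    (hW₁ : W₁ = Matrix.of fun (b : (↥(pbox (towerTorus Lc M' (n + 1))) × Fin (d + 1))) (e : NParam Lc M' rs (n + 1)) => -(c * h b * evalN Lc M' rs (n + 1) (fun b' : (↥(pbox (towerTorus Lc M' (n + 1))) × Fin (d + 1)) => (b'.1 : Site (d + 1)) + unitVec b'.2) b e))
    (hW₂ : W₂ = Matrix.of fun (b : (↥(pbox (towerTorus Lc M' (n + 1))) × Fin (d + 1))) (e : NParam Lc M' rs (n + 1)) => (c * h b) ^ 2 * evalN Lc M' rs (n + 1) (fun b' : (↥(pbox (towerTorus Lc M' (n + 1))) × Fin (d + 1)) => (b'.1 : Site (d + 1)) + unitVec b'.2) b e)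
    -- (COV-m) ORDER 0 PINNED (leaf-02 g21 `TorusCompositeCovariance`): `Dbar := σ_{n+1} • D̄`; the orders 1, 2 images stay displayed
    {Dbar : Matrix (↥(pbox M') × Fin (d + 1)) (Res (toSite (rs 0)) Lc M') ℝ}
    (hDbar : Dbar = (∏ i ∈ range (n + 1), (stepScale d Lc (lev (i + 1)) * ((box (d + 1) Lc).card : ℝ))) •
        (tgrad M').submatrix (fun a : ↥(pbox M') × Fin (d + 1) => ((a.1, Sum.inl a.2) : Idx M' (Fib d))) (fun t : Res (toSite (rs 0)) Lc M' => (t.1 : ↥(pbox M'))))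
    -- (COV-m) ORDER 0 AT THE TOP DEPTH in the pinned letters and the ONE-SHOT slice's transversality, DISPLAYED (R-FP-71; rooted: leaf-02
    -- `TorusCompositeCovariance.compRows_mul_towerGen_succ` ∕ leaf-06 `TorusCompositeSliceOneShot.torus_hTW_oneShot_tower`; sym: leaf-02's R-20
    -- `compRowsSym_mul_towerGen_succ` at the constant root list ∕ leaf-06 G-2 §2 `torus_hTW_oneShot_towerSym` fed R-20)
    (c0 : Q₁₀ * W₀ = fromCols Dbar (0 : Matrix (↥(pbox M') × Fin (d + 1)) (NParam Lc (fine Lc M') (fun k => rs (k + 1)) n) ℝ))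
    (hTW : (Matrix.fromRows (τ₂ * Q₁₀) τ₁ * W₀).det ≠ 0)
    (Db₁ Db₂ : Matrix (↥(pbox M') × Fin (d + 1)) (Res (toSite (rs 0)) Lc M') ℝ)
    (Y₁ Y₂ : Matrix κ (NParam Lc M' rs (n + 1)) ℝ)
    -- the chart transport (exponential currency): generators `X` (finest fields), `X̄` (coarse multipliers); one-shot chart's generator jets; parameter-transport jets
    {X : Matrix (↥(pbox (towerTorus Lc M' (n + 1))) × Fin (d + 1)) (↥(pbox (towerTorus Lc M' (n + 1))) × Fin (d + 1)) ℝ} (hX : X = -(c • Matrix.diagonal (fun b : (↥(pbox (towerTorus Lc M' (n + 1))) × Fin (d + 1)) => lam b.1))) (Xbar : Matrix κ κ ℝ)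
    {W'₁ W'₂ : Matrix (↥(pbox (towerTorus Lc M' (n + 1))) × Fin (d + 1)) (NParam Lc M' rs (n + 1)) ℝ}
    (hW'₁ : W'₁ = Matrix.of fun (b : (↥(pbox (towerTorus Lc M' (n + 1))) × Fin (d + 1))) (e : NParam Lc M' rs (n + 1)) =>
        -(c * (h b + ∑ s, tgrad (towerTorus Lc M' (n + 1)) (b.1, Sum.inl b.2) s * lam s) * evalN Lc M' rs (n + 1) (fun b' : (↥(pbox (towerTorus Lc M' (n + 1))) × Fin (d + 1)) => (b'.1 : Site (d + 1)) + unitVec b'.2) b e))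
    (hW'₂ : W'₂ = Matrix.of fun (b : (↥(pbox (towerTorus Lc M' (n + 1))) × Fin (d + 1))) (e : NParam Lc M' rs (n + 1)) =>
        (c * (h b + ∑ s, tgrad (towerTorus Lc M' (n + 1)) (b.1, Sum.inl b.2) s * lam s)) ^ 2 * evalN Lc M' rs (n + 1) (fun b' : (↥(pbox (towerTorus Lc M' (n + 1))) × Fin (d + 1)) => (b'.1 : Site (d + 1)) + unitVec b'.2) b e)
    {C₁ C₂ : Matrix (NParam Lc M' rs (n + 1)) (NParam Lc M' rs (n + 1)) ℝ} (hC₁ : C₁ = c • towerC₁ Lc M' rs (fun k => toSite_mem_range (hrs k)) (n + 1) lam) (hC₂ : C₂ = C₁ * C₁)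
    {𝔔₀ 𝔔₁ 𝔔₂ : Matrix κ (↥(pbox (towerTorus Lc M' (n + 1))) × Fin (d + 1)) ℝ}
    (h𝔔₀ : Q₂₀ * Q₁₀ = 𝔔₀) (h𝔔₁ : Q₂₁ * Q₁₀ + Q₂₀ * Q₁₁ = 𝔔₁) (h𝔔₂ : Q₂₂ * Q₁₀ + Q₂₁ * Q₁₁ + (Q₂₁ * Q₁₁ + Q₂₀ * Q₁₂) = 𝔔₂)
    -- (T-β-m) GRADED: the one-shot literal's composite jets are the graded `X`-conjugated words, NAMED
    {H'₁ H'₂ : Matrix (↥(pbox (towerTorus Lc M' (n + 1))) × Fin (d + 1)) (↥(pbox (towerTorus Lc M' (n + 1))) × Fin (d + 1)) ℝ}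
    {𝔔'₁ 𝔔'₂ : Matrix κ (↥(pbox (towerTorus Lc M' (n + 1))) × Fin (d + 1)) ℝ}
    (k1 : -(Xᵀ * H₀) + H₁ + H₀ * X = H'₁)
    (k2 : (X * X)ᵀ * H₀ + (-(Xᵀ * H₁) + -(Xᵀ * H₀ * X)) + ((-(Xᵀ * H₁) + -(Xᵀ * H₀ * X)) + (H₂ + H₁ * X + (H₁ * X + H₀ * (X * X)))) = H'₂)
    (q1 : Xbar * 𝔔₀ + 𝔔₁ + 𝔔₀ * X = 𝔔'₁)
    (q2 : Xbar * Xbar * 𝔔₀ + (Xbar * 𝔔₁ + Xbar * 𝔔₀ * X) + ((Xbar * 𝔔₁ + Xbar * 𝔔₀ * X) + (𝔔₂ + 𝔔₁ * X + (𝔔₁ * X + 𝔔₀ * (X * X)))) = 𝔔'₂)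
    -- (T-β-4) `j1 j2 uC` DISCHARGED (leaf-06 `TorusCompositeIntertwining.torus_j1_tower ∕ torus_j2_tower`, `TorusGeneratorIntertwining.torus_uC_exp`)
    -- (INV-m) `h1` and (EFF-m) `h2` follow INSIDE from `hone hId htop` by leaf-05 `TorusEffFormCompositeG.torus_composite_inv_and_eff_G`
    -- slice by an2's Literature `GaugeFixingPropagators.isUnit_det_kkt_sliceChange₃ ∕ blocks_sliceChange₃` (R-FP-55 (R3))
    {Γ : Matrix (↥(pbox (towerTorus Lc M' (n + 1))) × Fin (d + 1)) (↥(pbox (towerTorus Lc M' (n + 1))) × Fin (d + 1)) ℝ}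
    {I : Matrix (↥(pbox (towerTorus Lc M' (n + 1))) × Fin (d + 1)) ((↥(pbox M') × Fin (d + 1)) ⊕ NParam Lc (fine Lc M') (fun k => rs (k + 1)) n) ℝ}
    {L : Matrix ((↥(pbox M') × Fin (d + 1)) ⊕ NParam Lc (fine Lc M') (fun k => rs (k + 1)) n) (↥(pbox (towerTorus Lc M' (n + 1))) × Fin (d + 1)) ℝ}
    {S : Matrix ((↥(pbox M') × Fin (d + 1)) ⊕ NParam Lc (fine Lc M') (fun k => rs (k + 1)) n)
      ((↥(pbox M') × Fin (d + 1)) ⊕ NParam Lc (fine Lc M') (fun k => rs (k + 1)) n) ℝ}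
    {B : Matrix ((↥(pbox M') × Fin (d + 1)) ⊕ NParam Lc (fine Lc M') (fun k => rs (k + 1)) n) (↥(pbox (towerTorus Lc M' (n + 1))) × Fin (d + 1)) ℝ}
    (hΓ : flucCov H₀ (fromRows Q₁₀ τ₁) = Γ) (hI : minOp H₀ (fromRows Q₁₀ τ₁) = I) (hL : minOpL H₀ (fromRows Q₁₀ τ₁) = L) (hS : effForm H₀ (fromRows Q₁₀ τ₁) = S)
    (hB : fromRows Q₁₁ (0 : Matrix (NParam Lc (fine Lc M') (fun k => rs (k + 1)) n) (↥(pbox (towerTorus Lc M' (n + 1))) × Fin (d + 1)) ℝ) = B)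
    -- (SLICE-m) ALL DISCHARGED: `hPW uP'` (leaf-06 g20), `hTW` (leaf-06 g21 `TorusCompositeSliceOneShot`), the nested Faddeev–Popov 2-jet `uT`
    -- by leaf-06 g21's SPLIT `NestedFPSplit.secondVar_nestedFP_eq_zero_of_t_uLow` (block lower-triangular under `c0 c1 c2`; fine block `uLow`
    -- AUTOMATIC — `torus_uLow_oneShot_tower`, exponential jets on the one-shot comb one level down, NO deadness of the direction; coarse block from
    -- `t1 t2` = `TorusCompositeSlice` §2 over `c1 c2` + `hDb₁ hDb₂`); DISPLAYED instead of `hTW s1 s2 t1 t2`: ONLY «the composite insertion jets' coarse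
    -- images are DEAD on the top comb» (the (B) `hdead` shape) — no hypothesis on the fine direction `h` at all
    (hDb₁ : ∀ a : ↥(pbox M') × Fin (d + 1), IsCombBondAt (toSite (rs 0)) Lc a.2 (a.1 : Site (d + 1)) → Db₁ a = 0)
    (hDb₂ : ∀ a : ↥(pbox M') × Fin (d + 1), IsCombBondAt (toSite (rs 0)) Lc a.2 (a.1 : Site (d + 1)) → Db₂ a = 0)
    -- parities of the displayed form jets; the GRADED Ward rows of the finest form against the composite witnesses (NO transposed rows)
    (hH₁t : H₁ᵀ = -H₁) (hH₂t : H₂ᵀ = H₂)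
    -- (WARD-m) ORDER 0 DISPLAYED for the abstract form family (rooted: #20 §1 `torus_a0_tower`; the finest form's field block is brick-free); orders 1, 2 at `Y₀ := 0`
    (a0 : H₀ * W₀ = 0)
    (a1 : H₁ * W₀ + H₀ * W₁ = 𝔔₀ᵀ * Y₁)
    (a2 : H₂ * W₀ + (2 : ℝ) • (H₁ * W₁) + H₀ * W₂ = -((2 : ℝ) • (𝔔₁ᵀ * Y₁)) + 𝔔₀ᵀ * Y₂)
    -- (COV-m) ORDERS 1, 2 displayed (order 0 `c0` above); the top step's order 0 `d0` DISPLAYED (rooted: `Qtop_mul_smul_tgrad_res`)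
    (d0 : Q₂₀ * Dbar = 0)
    (c1 : Q₁₁ * W₀ + Q₁₀ * W₁ = fromCols Db₁ (0 : Matrix (↥(pbox M') × Fin (d + 1)) (NParam Lc (fine Lc M') (fun k => rs (k + 1)) n) ℝ))
    (c2 : Q₁₂ * W₀ + (2 : ℝ) • (Q₁₁ * W₁) + Q₁₀ * W₂ = fromCols Db₂ (0 : Matrix (↥(pbox M') × Fin (d + 1)) (NParam Lc (fine Lc M') (fun k => rs (k + 1)) n) ℝ))
    (d1 : Q₂₁ * Dbar + Q₂₀ * Db₁ = 0) (d2 : Q₂₂ * Dbar + (2 : ℝ) • (Q₂₁ * Db₁) + Q₂₀ * Db₂ = 0) :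
    secondVar (kkt H₀ (fromRows 𝔔₀ P))
        (fromBlocks H'₁ (-(fromRows 𝔔'₁ (0 : Matrix (NParam Lc M' rs (n + 1)) (↥(pbox (towerTorus Lc M' (n + 1))) × Fin (d + 1)) ℝ))ᵀ)
          (fromRows 𝔔'₁ (0 : Matrix (NParam Lc M' rs (n + 1)) (↥(pbox (towerTorus Lc M' (n + 1))) × Fin (d + 1)) ℝ)) 0)
        (kkt H'₂ (fromRows 𝔔'₂ (0 : Matrix (NParam Lc M' rs (n + 1)) (↥(pbox (towerTorus Lc M' (n + 1))) × Fin (d + 1)) ℝ)))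
      = secondVar (kkt H₀ (fromRows Q₁₀ τ₁)) (fromBlocks H₁ (-Bᵀ) B 0)
            (kkt H₂ (fromRows Q₁₂ (0 : Matrix (NParam Lc (fine Lc M') (fun k => rs (k + 1)) n) (↥(pbox (towerTorus Lc M' (n + 1))) × Fin (d + 1)) ℝ)))
        + secondVar
            (kkt S.toBlocks₁₁ (fromRows Q₂₀ τ₂))
            (fromBlocks ((L * H₁ - S * B) * I + L * Bᵀ * S).toBlocks₁₁ (-(fromRows Q₂₁ (0 : Matrix (Res (toSite (rs 0)) Lc M') (↥(pbox M') × Fin (d + 1)) ℝ))ᵀ)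
              (fromRows Q₂₁ (0 : Matrix (Res (toSite (rs 0)) Lc M') (↥(pbox M') × Fin (d + 1)) ℝ)) 0)
            (kkt (((-((L * H₁ - S * B) * Γ - L * Bᵀ * L) * H₁ + L * H₂
                      - (((L * H₁ - S * B) * I + L * Bᵀ * S) * B
                          + S * fromRows Q₁₂ (0 : Matrix (NParam Lc (fine Lc M') (fun k => rs (k + 1)) n) (↥(pbox (towerTorus Lc M' (n + 1))) × Fin (d + 1)) ℝ))) * I
                    + (L * H₁ - S * B) * (-((Γ * H₁ + I * B) * I + Γ * Bᵀ * S)))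
                  - ((-((L * H₁ - S * B) * Γ - L * Bᵀ * L) * (-Bᵀ)
                        + L * (fromRows Q₁₂ (0 : Matrix (NParam Lc (fine Lc M') (fun k => rs (k + 1)) n) (↥(pbox (towerTorus Lc M' (n + 1))) × Fin (d + 1)) ℝ))ᵀ) * S
                      + L * (-Bᵀ) * ((L * H₁ - S * B) * I + L * Bᵀ * S))).toBlocks₁₁
              (fromRows Q₂₂ (0 : Matrix (Res (toSite (rs 0)) Lc M') (↥(pbox M') × Fin (d + 1)) ℝ))) := by
  have hL0 : 0 < Lc := Nat.pos_of_ne_zero (NeZero.ne Lc)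
  -- leaf-05's GENERIC nested (INV) ∧ (EFF) from the displayed one-step letters
  have hIE := torus_composite_inv_and_eff_G Lc Q K n M' lev rs hlev hone hId
  -- the NESTED slice and the LOWER tower generators of the tower below `M′`, NAMED at the call's index types (the spellings
  -- `towerTorus Lc M′ (n+1)` ∕ `towerTorus Lc (fine Lc M′) n` are defeq only at default transparency — located, g19)
  obtain ⟨τn, hτn⟩ : ∃ τn : Matrix (NParam Lc (fine Lc M') (fun k => rs (k + 1)) n) (↥(pbox (towerTorus Lc M' (n + 1))) × Fin (d + 1)) ℝ,
      τn = nestedSliceG Lc Q (fine Lc M') (fun k => lev (k + 1)) (fun k => rs (k + 1)) n := ⟨_, rfl⟩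
  obtain ⟨Wl, hWl⟩ : ∃ Wl : Matrix (↥(pbox (towerTorus Lc M' (n + 1))) × Fin (d + 1)) (NParam Lc (fine Lc M') (fun k => rs (k + 1)) n) ℝ,
      Wl = towerGen Lc (fine Lc M') (fun k => rs (k + 1)) n := ⟨_, rfl⟩
  -- `W₀ = fromCols D_top Wl` (`towerGen_succ`, `rfl`): the lower generators are the right column block of `W₀`
  have hW2 : W₀.toCols₂ = Wl := by
    rw [hWl, hW₀]
    exact Matrix.toCols₂_fromCols _ _
  -- killed by `H₀` (right block of `a0`) and by `Q₁₀` (right block of `c0`)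
  have hKW : H₀ * Wl = 0 := by
    have h0 : H₀ * Matrix.fromCols W₀.toCols₁ W₀.toCols₂ = 0 := by rw [Matrix.fromCols_toCols]; exact a0
    rw [Matrix.mul_fromCols, ← Matrix.fromCols_zero] at h0
    rw [← hW2]
    exact (Matrix.fromCols_inj h0).2
  have hKtW : H₀ᵀ * Wl = 0 := by rw [hH₀t]; exact hKW
  have hQW : Q₁₀ * Wl = 0 := by
    have h0 : Q₁₀ * Matrix.fromCols W₀.toCols₁ W₀.toCols₂
        = Matrix.fromCols Dbar (0 : Matrix (↥(pbox M') × Fin (d + 1)) (NParam Lc (fine Lc M') (fun k => rs (k + 1)) n) ℝ) := by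
      rw [Matrix.fromCols_toCols]; exact c0
    rw [Matrix.mul_fromCols] at h0
    rw [← hW2]
    exact (Matrix.fromCols_inj h0).2
  -- transversal to both slices (the displayed `hSL` ∕ leaf-06 g20)
  have hT : (τn * Wl).det ≠ 0 := by
    rw [hτn, hWl]
    exact hSL
  have hSW : (τ₁ * Wl).det ≠ 0 := by
    rw [hτ₁, hWl]
    exact det_bigP_mul_towerGen_ne_zero Lc (fine Lc M') (fun k => rs (k + 1)) (fun k => toSite_mem_range (hrs (k + 1))) (dvd_fine M') n
  -- leaf-05's nested (INV)
  have hτn1 : (kkt H₀ (fromRows Q₁₀ τn)).det ≠ 0 := by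
    rw [hH₀, hQ₁₀, hτn]; exact hIE.1
  -- (INV) ∧ (EFF) ACROSS THE SLICE CHANGE (an2's Literature `GaugeFixingPropagators` §3c, three blocks)
  have h1 : (kkt H₀ (fromRows Q₁₀ τ₁)).det ≠ 0 :=
    (isUnit_det_kkt_sliceChange₃ H₀ Q₁₀ τn τ₁ Wl hKW hKtW hQW (isUnit_iff_ne_zero.2 hT) (isUnit_iff_ne_zero.2 hSW)
      (isUnit_iff_ne_zero.2 hτn1)).ne_zero
  have hEff : (effForm H₀ (fromRows Q₁₀ τ₁)).toBlocks₁₁ = (effForm H₀ (fromRows Q₁₀ τn)).toBlocks₁₁ := by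
    rw [(blocks_sliceChange₃ H₀ Q₁₀ τn τ₁ Wl hKW hKtW hQW (isUnit_iff_ne_zero.2 hT) (isUnit_iff_ne_zero.2 hSW)
      (isUnit_iff_ne_zero.2 hτn1)).2.2.2, toBlocks_fromBlocks₁₁]
  have hc : (∏ i ∈ range (n + 1), (wVH d Lc (lev i))⁻¹) ≠ 0 :=
    prod_ne_zero_iff.mpr fun i _ => inv_ne_zero (wVH_pos hL0 (lev i)).ne'
  have h2 : (kkt S.toBlocks₁₁ (fromRows Q₂₀ τ₂)).det ≠ 0 := by
    rw [← hS, hEff, hH₀, hQ₁₀, hτn, hIE.2 (rs 0), det_kkt_smul_form_ne_zero_iff hc]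
    exact htop
  -- the composite constraint rows from the covariance rows
  have b0 := compWard_b0 Q₁₀ Q₂₀ W₀ Dbar c0 d0 h𝔔₀
  have b1 := compWard_b1 Q₁₀ Q₁₁ Q₂₀ Q₂₁ W₀ W₁ Dbar Db₁ c0 c1 d1 h𝔔₀ h𝔔₁
  have b2 := compWard_b2 Q₁₀ Q₁₁ Q₁₂ Q₂₀ Q₂₁ Q₂₂ W₀ W₁ W₂ Dbar Db₁ Db₂ c0 c1 c2 d2 h𝔔₀ h𝔔₁ h𝔔₂
  -- (SLICE-m): `hTW` is displayed; the coarse dead rows from `c1 c2` (leaf-06 g21)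
  have t1 := torus_t1_tower_of_c1 M' Lc (hrs 0) hM' hτ₂ Q₁₀ Q₁₁ W₀ W₁ Db₁ c1 hDb₁
  have t2 := torus_t2_tower_of_c2 M' Lc (hrs 0) hM' hτ₂ Q₁₀ Q₁₁ Q₁₂ W₀ W₁ W₂ Db₂ c2 hDb₂
  -- the nested FP 2-jet `uT` by leaf-06's SPLIT: top block from `t1 t2`, fine block AUTOMATIC (exponential jets on the one-shot comb one level down)
  have hup : (τ₂ * Dbar).det ≠ 0 := by
    rw [hτ₂, hDbar]; exact det_combF_mul_smul_tgrad_res_ne_zero Lc M' (hrs 0) hM' (prod_stepScale_mul_card_ne_zero (d := d) Lc lev (n + 1))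
  have hlow : (τ₁ * W₀.toCols₂).det ≠ 0 := by rw [hW2]; exact hSW
  have uLow := torus_uLow_oneShot_tower M' Lc rs n hrs c h hτ₁ hW₀ hW₁ hW₂
  have uT := secondVar_nestedFP_eq_zero_of_t_uLow τ₁ τ₂ Q₁₀ Q₁₁ Q₁₂ W₀ W₁ W₂ Dbar Db₁ Db₂ c0 c1 c2 hup hlow t1 t2 uLow
  -- the GRADED transported law (exponential currency; colour lift inside) with `G = 0`, every (T-β-4) ∕ (SLICE-m) letter supplied BY NAME
  have hlaw := secondVar_oneShot_nestedStepLaw_expTransported_graded_of_uni H₀ H₁ H₂ Q₁₀ Q₁₁ Q₁₂ Q₂₀ Q₂₁ Q₂₂ 0 0 0 τ₁ τ₂ P W₀ W₁ W₂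
    0 Y₁ Y₂ X Xbar W'₁ W'₂ C₁ C₂
    (show H₀ + Q₁₀ᵀ * (0 : Matrix (↥(pbox M') × Fin (d + 1)) (↥(pbox M') × Fin (d + 1)) ℝ) * Q₁₀ = H₀ by rw [Matrix.mul_zero, Matrix.zero_mul, add_zero])
    (show H₁ + (-(Q₁₁ᵀ * (0 : Matrix (↥(pbox M') × Fin (d + 1)) (↥(pbox M') × Fin (d + 1)) ℝ) * Q₁₀)
        + Q₁₀ᵀ * (0 : Matrix (↥(pbox M') × Fin (d + 1)) (↥(pbox M') × Fin (d + 1)) ℝ) * Q₁₀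
        + Q₁₀ᵀ * (0 : Matrix (↥(pbox M') × Fin (d + 1)) (↥(pbox M') × Fin (d + 1)) ℝ) * Q₁₁) = H₁ by simp only [Matrix.mul_zero, Matrix.zero_mul, neg_zero, add_zero])
    (show H₂ + ((Q₁₂ᵀ * (0 : Matrix (↥(pbox M') × Fin (d + 1)) (↥(pbox M') × Fin (d + 1)) ℝ) * Q₁₀
          + -(Q₁₁ᵀ * (0 : Matrix (↥(pbox M') × Fin (d + 1)) (↥(pbox M') × Fin (d + 1)) ℝ) * Q₁₀)
          + -(Q₁₁ᵀ * (0 : Matrix (↥(pbox M') × Fin (d + 1)) (↥(pbox M') × Fin (d + 1)) ℝ) * Q₁₁))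
        + (-(Q₁₁ᵀ * (0 : Matrix (↥(pbox M') × Fin (d + 1)) (↥(pbox M') × Fin (d + 1)) ℝ) * Q₁₀)
          + Q₁₀ᵀ * (0 : Matrix (↥(pbox M') × Fin (d + 1)) (↥(pbox M') × Fin (d + 1)) ℝ) * Q₁₀
          + Q₁₀ᵀ * (0 : Matrix (↥(pbox M') × Fin (d + 1)) (↥(pbox M') × Fin (d + 1)) ℝ) * Q₁₁)
        + (-(Q₁₁ᵀ * (0 : Matrix (↥(pbox M') × Fin (d + 1)) (↥(pbox M') × Fin (d + 1)) ℝ) * Q₁₁)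
          + Q₁₀ᵀ * (0 : Matrix (↥(pbox M') × Fin (d + 1)) (↥(pbox M') × Fin (d + 1)) ℝ) * Q₁₁
          + Q₁₀ᵀ * (0 : Matrix (↥(pbox M') × Fin (d + 1)) (↥(pbox M') × Fin (d + 1)) ℝ) * Q₁₂)) = H₂ by simp only [Matrix.mul_zero, Matrix.zero_mul, neg_zero, add_zero])
    h𝔔₀ h𝔔₁ h𝔔₂ k1 k2 q1 q2
    (by rw [hW₀, hC₁]; exact torus_j1_tower Lc M' rs _ (n + 1) lam c h hX hW₁ hW'₁)
    (by rw [hW₀, hC₂, hC₁]; exact torus_j2_tower Lc M' rs _ (n + 1) lam c h hX hW₁ hW'₁ hW₂ hW'₂)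
    (by rw [hC₂, hC₁]; exact torus_uC_exp c _)
    (by rw [hP, hW₀, hW'₁, hW'₂]
        exact torus_uP_exp_tower Lc M' rs _ hM' (n + 1) c
          (fun b : (↥(pbox (towerTorus Lc M' (n + 1))) × Fin (d + 1)) => (h b + ∑ s, tgrad (towerTorus Lc M' (n + 1)) (b.1, Sum.inl b.2) s * lam s)) rfl rfl)
    uT
    hH₀t hH₁t hH₂t (by rw [Matrix.mul_zero]; exact a0) (by rw [Matrix.mul_zero, neg_zero, zero_add]; exact a1)
    (by rw [Matrix.mul_zero, zero_add]; exact a2) b0 b1 b2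
    (by rw [hP, hW₀]; exact det_bigP_mul_towerGen_ne_zero Lc M' rs _ hM' (n + 1)) hTW hΓ hI hL hS hB h1 (by rw [add_zero]; exact h2)
  simp only [add_zero] at hlaw
  exact hlaw

end CompositeOneShotG

end Summit.QuantumFields.BalabanUV.Beta.FP.NestedStepLawTorusCompositeOneShotGB

end
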